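import Summits.Ventures.HodgeRepro2.T5SU11ResolventL1Class

/-!
# The resolvent on `L²(sinh 2t dt)` for `λ > 2` by Schur's test: every square-integrable source of the class

Rows 528 and 532 bound `‖G^I_λ g‖₂ ≤ ‖g‖₂/μ` (`λ > 2`) and `‖G^I_λ g‖₂ ≤ ‖g‖₂/(λ − 1)²` (`λ > 1`) for sources of the
class at a rate `ε > 1`, through the energy identity. Here the `L²` bound for `λ > 2` (`μ = λ(λ − 2) > 0`) is obtained
by **Schur's test** on the kernel, whose row and column sums are both `1/μ` (rows 543, 546): for a source `g` of the class
(rate `ε > 2 − λ`, which only guarantees that `G^I_λ g` is defined) with **`g² sinh 2s ∈ L¹(0, ∞)`**,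

* `sq_integral_le_integral_mul_integral_sq` — the weighted Cauchy–Schwarz inequality `(∫ w h)² ≤ (∫ w)(∫ w h²)` for a
  non-negative weight `w` (the discriminant of `c ↦ ∫ w (h − c)² ≥ 0`);
* `integrable_prod_kernel_sq` — the product integrand `|K_λ(t, s)| g(s)² sinh 2s · sinh 2t` is integrable on `(0, ∞)²`;
* `ae_sq_greenSolI_mul_sinh_le` — **`G^I_λ g(t)² sinh 2t ≤ (1/μ) ∫_s |K_λ(t, s)| g(s)² sinh 2s · sinh 2t ds`** for a.e.
  `t > 0` (Cauchy–Schwarz with the weight `|K_λ(t, ·)| sinh 2s` of mass `1/μ`);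
* `integrableOn_sinh_mul_greenSolI_sq_of_integrable` — **`sinh 2t · G^I_λ g(t)²` is integrable on `(0, ∞)`**: the
  resolvent maps `L²(sinh 2t dt) ∩ class` into `L²(sinh 2t dt)`;
* `integral_sinh_mul_greenSolI_sq_le_of_integrable` — **`∫ sinh 2t (G^I_λ g)² ≤ (∫ sinh 2s g²)/μ²`** — the `L²` operator
  norm of `(L − μ)⁻¹` is at most `1/μ` for every square-integrable source of the class (Schur: `√(A·B)` with the row and
  column sums `A = B = 1/μ`).

Nothing is claimed about (N).

Blind lane: Mathlib + the HodgeRepro2 prefix only; no sorry; axioms ⊆ {propext, Classical.choice,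
Quot.sound}.
-/

namespace Summit.Ventures.HodgeRepro2.T5SU11ResolventL2Schur

open Filter Topology MeasureTheory
open Set (Ioi Ioc)
open T5SU11Cartan T5SU11SphericalFunction T5SU11SphericalDecay T5SU11RadialGreenKernel
  T5SU11RadialGreenImproper T5SU11RadialGreenImproperDecaySource T5SU11RadialGreenImproperStable
  T5SU11ResolventKernelComposition T5SU11ResolventTransformClass T5SU11ResolventSupNorm
  T5SU11ResolventConstantSource T5SU11RadialGreenPositivity T5SU11SphericalContinuous

/-- **The weighted Cauchy–Schwarz inequality**: for a weight `w ≥ 0` on a measurable set `S` with `w`, `w h`, `w h²`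
integrable, `(∫_S w h)² ≤ (∫_S w) (∫_S w h²)` — the discriminant of the non-negative quadratic `c ↦ ∫_S w (h − c)²`. -/
theorem sq_integral_le_integral_mul_integral_sq {S : Set ℝ} (hS : MeasurableSet S) {w h : ℝ → ℝ}
    (hw0 : ∀ s ∈ S, 0 ≤ w s) (hw : IntegrableOn w S) (hwh : IntegrableOn (fun s => w s * h s) S)
    (hwh2 : IntegrableOn (fun s => w s * h s ^ 2) S) :
    (∫ s in S, w s * h s) ^ 2 ≤ (∫ s in S, w s) * ∫ s in S, w s * h s ^ 2 := by
  have key : ∀ c : ℝ, 0 ≤ (∫ s in S, w s) * (c * c) + (-2 * ∫ s in S, w s * h s) * c + ∫ s in S, w s * h s ^ 2 := by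
    intro c
    have hnn : 0 ≤ ∫ s in S, w s * (h s - c) ^ 2 :=
      setIntegral_nonneg hS (fun s hs => mul_nonneg (hw0 s hs) (sq_nonneg _))
    have e : ∫ s in S, w s * (h s - c) ^ 2
        = (∫ s in S, w s * h s ^ 2) - (2 * c) * (∫ s in S, w s * h s) + c ^ 2 * ∫ s in S, w s := by
      have h1 : ∫ s in S, w s * (h s - c) ^ 2
          = ∫ s in S, ((w s * h s ^ 2 - (2 * c) * (w s * h s)) + c ^ 2 * w s) :=
        setIntegral_congr_fun hS (fun s _ => by ring)
      have hA : IntegrableOn (fun s => (2 * c) * (w s * h s)) S := hwh.const_mul _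
      have hB : IntegrableOn (fun s => c ^ 2 * w s) S := hw.const_mul _
      have hAB : IntegrableOn (fun s => w s * h s ^ 2 - (2 * c) * (w s * h s)) S := hwh2.sub hA
      rw [h1, integral_add hAB hB, integral_sub hwh2 hA, integral_const_mul, integral_const_mul]
    rw [e] at hnn
    nlinarith [hnn]
  have hd := discrim_le_zero key
  unfold discrim at hd
  nlinarith [hd]

section measure

variable [MeasurableSpace Circle] [BorelSpace Circle]

variable {lam : ℝ} (h2 : 2 < lam) {g : ℝ → ℝ} (hg : ContinuousOn g (Ioi 0))
  {M : ℝ} (hM : ∀ s ∈ Ioc (0 : ℝ) 1, |g s| ≤ M) (hM0 : 0 ≤ M)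
  {ε C s₀ : ℝ} (hε : 2 - lam < ε) (hC : ∀ s, s₀ ≤ s → |g s| ≤ C * Real.exp (-ε * s))
  (hg2 : IntegrableOn (fun s => Real.sinh (2 * s) * g s ^ 2) (Ioi 0))

include h2 hg hg2 in
/-- **The product integrand `|K_λ(t, s)| g(s)² sinh 2s · sinh 2t` is integrable on `(0, ∞)²`** for `λ > 2` and every
continuous source with `g² sinh 2s ∈ L¹(0, ∞)`. -/
theorem integrable_prod_kernel_sq :
    Integrable (Function.uncurry fun t s => |sphGreenKernel lam t s| * (Real.sinh (2 * s) * g s ^ 2) * Real.sinh (2 * t))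
      ((volume.restrict (Ioi 0)).prod (volume.restrict (Ioi 0))) := by
  have hlam : 1 < lam := by linarith
  have hχ : ContinuousOn (sphDecay lam) (Ioi 0) :=
    fun _ hr => (hasDerivAt_sphDecay hlam hr).continuousAt.continuousWithinAt
  -- measurability: the integrand is continuous on the open quadrant
  have hmeas : AEStronglyMeasurable (Function.uncurry fun t s => |sphGreenKernel lam t s|
      * (Real.sinh (2 * s) * g s ^ 2) * Real.sinh (2 * t)) ((volume.restrict (Ioi 0)).prod (volume.restrict (Ioi 0))) := by
    rw [Measure.prod_restrict]
    refine ContinuousOn.aestronglyMeasurable ?_ (measurableSet_Ioi.prod measurableSet_Ioi)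
    have hK : ContinuousOn (fun p : ℝ × ℝ => sphGreenKernel lam p.1 p.2) (Ioi 0 ×ˢ Ioi 0) := by
      simp only [sphGreenKernel, greenKernel]
      apply ContinuousOn.neg
      apply ContinuousOn.mul
      · exact ((continuous_sph_hyp lam).comp (continuous_fst.min continuous_snd)).continuousOn
      · exact hχ.comp (continuous_fst.max continuous_snd).continuousOn
          (fun p hp => Set.mem_Ioi.mpr (lt_of_lt_of_le (Set.mem_Ioi.mp hp.1) (le_max_left _ _)))
    have hg' : ContinuousOn (fun p : ℝ × ℝ => g p.2) (Ioi 0 ×ˢ Ioi 0) :=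
      hg.comp continuous_snd.continuousOn (fun p hp => hp.2)
    exact ((hK.abs.mul
      ((Real.continuous_sinh.comp (continuous_const.mul continuous_snd)).continuousOn.mul (hg'.pow 2)))).mul
      (Real.continuous_sinh.comp (continuous_const.mul continuous_fst)).continuousOn
  rw [integrable_prod_iff' hmeas]
  refine ⟨?_, ?_⟩
  · -- for every `s > 0`, the column `t ↦ |K_λ(t, s)| sinh 2t · g(s)² sinh 2s` is integrable
    refine (ae_restrict_iff' measurableSet_Ioi).mpr (Eventually.of_forall fun s hs => ?_)
    have hs0 : 0 < s := hs
    have h := (T5SU11ResolventL1Class.integrableOn_abs_sphGreenKernel_mul_sinh_fst h2 hs0).mul_const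
      (Real.sinh (2 * s) * g s ^ 2)
    refine h.congr (Eventually.of_forall fun t => ?_)
    simp only [Function.uncurry_apply_pair]
    ring
  · -- the outer function `s ↦ ∫_t ‖F(t, s)‖ dt = g(s)² sinh 2s/μ` is integrable
    have hI := hg2.mul_const (1 / (lam * (lam - 2)))
    refine hI.congr ?_
    refine (ae_restrict_iff' measurableSet_Ioi).mpr (Eventually.of_forall fun s hs => ?_)
    have hs0 : 0 < s := hs
    have hsinh : 0 ≤ Real.sinh (2 * s) := Real.sinh_nonneg_iff.mpr (by linarith)
    have e : ∀ t, ‖Function.uncurry (fun t s => |sphGreenKernel lam t s| * (Real.sinh (2 * s) * g s ^ 2)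
        * Real.sinh (2 * t)) (t, s)‖
        = |(|sphGreenKernel lam t s| * Real.sinh (2 * t))| * (Real.sinh (2 * s) * g s ^ 2) := by
      intro t
      simp only [Function.uncurry_apply_pair, Real.norm_eq_abs]
      rw [show |sphGreenKernel lam t s| * (Real.sinh (2 * s) * g s ^ 2) * Real.sinh (2 * t)
        = (|sphGreenKernel lam t s| * Real.sinh (2 * t)) * (Real.sinh (2 * s) * g s ^ 2) by ring,
        abs_mul, abs_of_nonneg (mul_nonneg hsinh (sq_nonneg _))]
    simp only [e]
    rw [MeasureTheory.integral_mul_const]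
    have hcol : ∫ t in Ioi 0, |(|sphGreenKernel lam t s| * Real.sinh (2 * t))| = 1 / (lam * (lam - 2)) := by
      rw [← T5SU11ResolventL1Class.integral_abs_sphGreenKernel_mul_sinh_fst h2 hs0]
      apply setIntegral_congr_fun measurableSet_Ioi
      intro t ht
      have ht0 : 0 < t := ht
      simp only
      rw [abs_of_nonneg (mul_nonneg (abs_nonneg _) (Real.sinh_nonneg_iff.mpr (by linarith)))]
    rw [hcol]
    ring

include h2 hg hM hM0 hε hC in
/-- **Cauchy–Schwarz on the kernel at one point**: if `s ↦ |K_λ(t, s)| g(s)² sinh 2s` is integrable, then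
`G^I_λ g(t)² ≤ (1/μ) ∫_s |K_λ(t, s)| g(s)² sinh 2s ds` (`t > 0`, `λ > 2`). -/
theorem sq_greenSolI_le_of_integrable {t : ℝ} (ht : 0 < t)
    (hI : IntegrableOn (fun s => |sphGreenKernel lam t s| * Real.sinh (2 * s) * g s ^ 2) (Ioi 0)) :
    greenSolI (fun t => sph lam (hyp t)) (sphDecay lam) g t ^ 2
      ≤ (1 / (lam * (lam - 2))) * ∫ s in Ioi 0, |sphGreenKernel lam t s| * Real.sinh (2 * s) * g s ^ 2 := by
  have hlam : 1 < lam := by linarith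
  have hB := integrableOn_sph_mul_mul_sinh_Ioc hg hM hM0 lam
  have hA := integrableOn_sphDecay_mul_mul_sinh hlam hg hM hM0 hε hC
  -- the weight `w(s) = |K_λ(t, s)| sinh 2s` (mass `1/μ`) and `h = −g`: `G^I_λ g(t) = ∫ w h`
  have hw : IntegrableOn (fun s => |sphGreenKernel lam t s| * Real.sinh (2 * s)) (Ioi 0) := by
    have hI1 := integrableOn_kernel_mul (φ := fun t => sph lam (hyp t)) (χ := sphDecay lam) (g := fun _ => (1 : ℝ))
      (fun T => integrableOn_sph_mul_one_mul_sinh lam T) (integrableOn_sphDecay_mul_one_mul_sinh h2) ht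
    refine hI1.neg.congr_fun (fun s _ => ?_) measurableSet_Ioi
    simp only [Pi.neg_apply]
    rw [abs_of_neg (sphGreenKernel_neg hlam ht)]
    unfold sphGreenKernel
    ring
  have hwh : IntegrableOn (fun s => |sphGreenKernel lam t s| * Real.sinh (2 * s) * (-g s)) (Ioi 0) := by
    refine (integrableOn_kernel_mul hB hA ht).congr_fun (fun s _ => ?_) measurableSet_Ioi
    simp only
    rw [abs_of_neg (sphGreenKernel_neg hlam ht)]
    unfold sphGreenKernel
    ring
  have hwh2 : IntegrableOn (fun s => |sphGreenKernel lam t s| * Real.sinh (2 * s) * (-g s) ^ 2) (Ioi 0) := by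
    refine hI.congr_fun (fun s _ => ?_) measurableSet_Ioi
    simp only
    ring
  have hcs := sq_integral_le_integral_mul_integral_sq measurableSet_Ioi
    (w := fun s => |sphGreenKernel lam t s| * Real.sinh (2 * s)) (h := fun s => -g s)
    (fun s hs => mul_nonneg (abs_nonneg _) (Real.sinh_nonneg_iff.mpr (by linarith [Set.mem_Ioi.mp hs]))) hw hwh hwh2
  have hrep : greenSolI (fun t => sph lam (hyp t)) (sphDecay lam) g t
      = ∫ s in Ioi 0, |sphGreenKernel lam t s| * Real.sinh (2 * s) * (-g s) := by
    rw [greenSolI_eq_integral_kernel hB hA ht]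
    apply setIntegral_congr_fun measurableSet_Ioi
    intro s _
    simp only
    rw [abs_of_neg (sphGreenKernel_neg hlam ht)]
    unfold sphGreenKernel
    ring
  have hmass := integral_abs_sphGreenKernel_mul_sinh h2 ht
  have e2 : ∫ s in Ioi 0, |sphGreenKernel lam t s| * Real.sinh (2 * s) * (-g s) ^ 2
      = ∫ s in Ioi 0, |sphGreenKernel lam t s| * Real.sinh (2 * s) * g s ^ 2 := by
    apply setIntegral_congr_fun measurableSet_Ioi
    intro s _
    simp only
    ring
  rw [hrep]
  rw [hmass, e2] at hcs
  exact hcs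

include h2 hg hM hM0 hε hC hg2 in
/-- **The pointwise Schur bound holds almost everywhere**: `sinh 2t · G^I_λ g(t)² ≤ (1/μ) ∫_s F(t, s) ds` for a.e. `t > 0`,
where `F(t, s) = |K_λ(t, s)| g(s)² sinh 2s · sinh 2t`. -/
theorem ae_sq_greenSolI_mul_sinh_le :
    ∀ᵐ t ∂(volume.restrict (Ioi 0)), Real.sinh (2 * t) * greenSolI (fun t => sph lam (hyp t)) (sphDecay lam) g t ^ 2
      ≤ (1 / (lam * (lam - 2))) * ∫ s in Ioi 0, Function.uncurry (fun t s => |sphGreenKernel lam t s|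
        * (Real.sinh (2 * s) * g s ^ 2) * Real.sinh (2 * t)) (t, s) := by
  have hF := integrable_prod_kernel_sq h2 hg hg2
  have hsec := hF.prod_right_ae
  have hmem : ∀ᵐ t : ℝ ∂(volume.restrict (Ioi (0 : ℝ))), t ∈ Ioi 0 := ae_restrict_mem measurableSet_Ioi
  filter_upwards [hsec, hmem] with t hsec_t ht
  have ht0 : 0 < t := ht
  have hsinh : 0 < Real.sinh (2 * t) := Real.sinh_pos_iff.mpr (by linarith)
  -- the section at `t`, divided by `sinh 2t`, is integrable
  have hI : IntegrableOn (fun s => |sphGreenKernel lam t s| * Real.sinh (2 * s) * g s ^ 2) (Ioi 0) := by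
    have h := hsec_t.const_mul (1 / Real.sinh (2 * t))
    refine h.congr (Eventually.of_forall fun s => ?_)
    simp only [Function.uncurry_apply_pair]
    field_simp
  have hcs := sq_greenSolI_le_of_integrable h2 hg hM hM0 hε hC ht0 hI
  have e : ∫ s in Ioi 0, Function.uncurry (fun t s => |sphGreenKernel lam t s| * (Real.sinh (2 * s) * g s ^ 2)
      * Real.sinh (2 * t)) (t, s)
      = Real.sinh (2 * t) * ∫ s in Ioi 0, |sphGreenKernel lam t s| * Real.sinh (2 * s) * g s ^ 2 := by
    rw [← MeasureTheory.integral_const_mul]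
    apply setIntegral_congr_fun measurableSet_Ioi
    intro s _
    simp only [Function.uncurry_apply_pair]
    ring
  rw [e]
  calc Real.sinh (2 * t) * greenSolI (fun t => sph lam (hyp t)) (sphDecay lam) g t ^ 2
      ≤ Real.sinh (2 * t) * ((1 / (lam * (lam - 2)))
          * ∫ s in Ioi 0, |sphGreenKernel lam t s| * Real.sinh (2 * s) * g s ^ 2) :=
        mul_le_mul_of_nonneg_left hcs hsinh.le
    _ = (1 / (lam * (lam - 2))) * (Real.sinh (2 * t)
          * ∫ s in Ioi 0, |sphGreenKernel lam t s| * Real.sinh (2 * s) * g s ^ 2) := by ring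

include h2 hg hM hM0 hε hC hg2 in
/-- **THE RESOLVENT PRESERVES `L²(sinh 2t dt)`**: for `λ > 2` and a source `g` of the class with `g² sinh 2s ∈ L¹(0, ∞)`,
`sinh 2t · G^I_λ g(t)²` is integrable on `(0, ∞)`. -/
theorem integrableOn_sinh_mul_greenSolI_sq_of_integrable :
    IntegrableOn (fun t => Real.sinh (2 * t) * greenSolI (fun t => sph lam (hyp t)) (sphDecay lam) g t ^ 2) (Ioi 0) := by
  have hlam : 1 < lam := by linarith
  have hμ : 0 < lam * (lam - 2) := mul_pos (by linarith) (by linarith)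
  have hF := integrable_prod_kernel_sq h2 hg hg2
  have hH := hF.integral_prod_left.const_mul (1 / (lam * (lam - 2)))
  have hcont : ContinuousOn (fun t => Real.sinh (2 * t) * greenSolI (fun t => sph lam (hyp t)) (sphDecay lam) g t ^ 2)
      (Ioi 0) :=
    (Real.continuous_sinh.comp (continuous_const.mul continuous_id)).continuousOn.mul
      ((continuousOn_greenSolI hlam hg hM hM0 hε hC).pow 2)
  refine Integrable.mono' hH (hcont.aestronglyMeasurable measurableSet_Ioi) ?_
  have hae := ae_sq_greenSolI_mul_sinh_le h2 hg hM hM0 hε hC hg2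
  have hmem : ∀ᵐ t : ℝ ∂(volume.restrict (Ioi (0 : ℝ))), t ∈ Ioi 0 := ae_restrict_mem measurableSet_Ioi
  filter_upwards [hae, hmem] with t hle ht
  have ht0 : 0 < t := ht
  have hsinh : 0 ≤ Real.sinh (2 * t) := Real.sinh_nonneg_iff.mpr (by linarith)
  rw [Real.norm_eq_abs, abs_of_nonneg (mul_nonneg hsinh (sq_nonneg _))]
  exact hle

include h2 hg hM hM0 hε hC hg2 in
/-- **THE `L²` BOUND OF THE RESOLVENT BY SCHUR'S TEST, FOR EVERY SQUARE-INTEGRABLE SOURCE OF THE CLASS**: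
`∫_{(0,∞)} sinh 2t (G^I_λ g)² ≤ (∫_{(0,∞)} sinh 2s g²)/μ²` for `λ > 2` — the `L²(sinh 2t dt)` operator norm of `(L − μ)⁻¹`
is at most `1/μ`, the geometric mean of the row and column sums of the kernel. -/
theorem integral_sinh_mul_greenSolI_sq_le_of_integrable :
    ∫ t in Ioi 0, Real.sinh (2 * t) * greenSolI (fun t => sph lam (hyp t)) (sphDecay lam) g t ^ 2
      ≤ (∫ s in Ioi 0, Real.sinh (2 * s) * g s ^ 2) / (lam * (lam - 2)) ^ 2 := by
  have hμ : 0 < lam * (lam - 2) := mul_pos (by linarith) (by linarith)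
  have hF := integrable_prod_kernel_sq h2 hg hg2
  have hswap := integral_integral_swap hF
  -- the left-hand side is dominated by `(1/μ)` times the iterated integral
  have hleft : ∫ t in Ioi 0, Real.sinh (2 * t) * greenSolI (fun t => sph lam (hyp t)) (sphDecay lam) g t ^ 2
      ≤ ∫ t in Ioi 0, (1 / (lam * (lam - 2))) * ∫ s in Ioi 0, Function.uncurry (fun t s => |sphGreenKernel lam t s|
        * (Real.sinh (2 * s) * g s ^ 2) * Real.sinh (2 * t)) (t, s) :=
    integral_mono_ae (integrableOn_sinh_mul_greenSolI_sq_of_integrable h2 hg hM hM0 hε hC hg2)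
      (hF.integral_prod_left.const_mul _) (ae_sq_greenSolI_mul_sinh_le h2 hg hM hM0 hε hC hg2)
  -- the swapped iterated integral is `∫_s g(s)² sinh 2s/μ`
  have hright : ∫ s in Ioi 0, ∫ t in Ioi 0, |sphGreenKernel lam t s| * (Real.sinh (2 * s) * g s ^ 2) * Real.sinh (2 * t)
      = (∫ s in Ioi 0, Real.sinh (2 * s) * g s ^ 2) / (lam * (lam - 2)) := by
    rw [← MeasureTheory.integral_div]
    apply setIntegral_congr_fun measurableSet_Ioi
    intro s hs
    have hs0 : 0 < s := hs
    simp only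
    have e : ∀ t, |sphGreenKernel lam t s| * (Real.sinh (2 * s) * g s ^ 2) * Real.sinh (2 * t)
        = |sphGreenKernel lam t s| * Real.sinh (2 * t) * (Real.sinh (2 * s) * g s ^ 2) := fun t => by ring
    simp only [e]
    rw [MeasureTheory.integral_mul_const, T5SU11ResolventL1Class.integral_abs_sphGreenKernel_mul_sinh_fst h2 hs0]
    ring
  have hswap' : ∫ t in Ioi 0, ∫ s in Ioi 0, Function.uncurry (fun t s => |sphGreenKernel lam t s|
        * (Real.sinh (2 * s) * g s ^ 2) * Real.sinh (2 * t)) (t, s)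
      = ∫ s in Ioi 0, ∫ t in Ioi 0, |sphGreenKernel lam t s| * (Real.sinh (2 * s) * g s ^ 2) * Real.sinh (2 * t) := by
    simpa only [Function.uncurry_apply_pair] using hswap
  calc ∫ t in Ioi 0, Real.sinh (2 * t) * greenSolI (fun t => sph lam (hyp t)) (sphDecay lam) g t ^ 2
      ≤ ∫ t in Ioi 0, (1 / (lam * (lam - 2))) * ∫ s in Ioi 0, Function.uncurry (fun t s => |sphGreenKernel lam t s|
          * (Real.sinh (2 * s) * g s ^ 2) * Real.sinh (2 * t)) (t, s) := hleft
    _ = (1 / (lam * (lam - 2))) * ∫ t in Ioi 0, ∫ s in Ioi 0, Function.uncurry (fun t s => |sphGreenKernel lam t s|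
          * (Real.sinh (2 * s) * g s ^ 2) * Real.sinh (2 * t)) (t, s) := MeasureTheory.integral_const_mul _ _
    _ = (1 / (lam * (lam - 2))) * ((∫ s in Ioi 0, Real.sinh (2 * s) * g s ^ 2) / (lam * (lam - 2))) := by
          rw [hswap', hright]
    _ = (∫ s in Ioi 0, Real.sinh (2 * s) * g s ^ 2) / (lam * (lam - 2)) ^ 2 := by
          rw [one_div, ← div_eq_inv_mul, div_div, ← pow_two]

end measure

end Summit.Ventures.HodgeRepro2.T5SU11ResolventL2Schur
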